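import Summits.HodgeConjecture.HodgeConjecture.Theorems.F0P2iGRDSplit             -- ★ p817998 (p01): GRD-(S) `grdMatrix_split_of_dictionary`
import Summits.HodgeConjecture.HodgeConjecture.Theorems.F0P2iGRDWitness           -- ★ p819322 (p01): DICT-CHOICE witness `grdMu`∕`grdChi` + pins + (Dν)∕(Dψ)
import Summits.HodgeConjecture.HodgeConjecture.Theorems.F0P2iVocabularyBridge   -- ★ p818933 (A-p17): `thetaTypeAt_iff_CM` (pulls ★ p818127 `CMThetaTypeVocabulary`)
import HarnessLib

/-!
# FLOOR-0 P2 — PKΠ RUNG 4, row «GRD-(S)-AT-WITNESS»: the split half of the Gelbart–Rogawski dictionary AT THE DICTIONARY PAIR `(μ_ξ, χ_f)`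

Cell hodgecm-mathlib (D-0151), FLOOR 0, programme P2 (theta ∕ `hdictE`); crux item H413 = stmt-HodgeConjecture-24833 (`HCCMUnconditional.H413`).
Sub-line of record `Cruxes/H413/Lines/F0_P2PKPiRung4.lean` (v1.2, F0P2-plan (g6)); row dealt 2026-08-31T09:52:55Z (2) ∕ 09:59:07Z to seat F0P2-p02 (g4).
THEOREMS ONLY (no `def`, no instance, no notation, no named fact, no `sorry`); never imports a `Cruxes/…/Lines` module (O50-1 ∕ s347 ∕ s380b);
`--supports stmt-HodgeConjecture-24833 --as helper`.  HC_CM is proved only modulo the printed citations until rung 0 closes; this file discharges none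
of them — it is the (S) summand of the pinned GRD core `grdMatrix_grdMu_grdChi_of_GR91N` (A-p17 (g15), `Theorems/F0P2iGRDAssembly.lean`) consumed by
the v1.4 head.

WHAT.  ★ p817998 `F0P2iGRDSplit.grdMatrix_split_of_dictionary` proves conjunct (S) of the finite dictionary `GRDMatrix … ξ μω hμu μ hμ χf` («at a place
`v` split in `L` every member of every ξ-local family is a `(μ, χf)`-theta type of some line class» [Rogawski1990 Lemma 4.13.1 (b); Minguez2008 Thm. 1])
for EVERY pair `(μ, χf)` — `χf` unitary and continuous — satisfying the two split identities (Dν) `splitν₀ ξ μω w = μ̃_w` and (Dψ)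
`locψ ξ w = χ′_w · μ̃_w^{1-3}`.  ★ p819322 `F0P2iGRDWitness` (the DICT-CHOICE PROTOCOL's named pair) supplies `μ_ξ := grdMu L ξ μω hμu`
(`toHeckeCharacter (grdMu …) = η̃⁻¹ ψ̃⁻¹ μω`, conjugate-symplectic under the S2♭ binder `hquad`) and `χ_f := grdChi L ξ μω hquad` (continuous, unitary,
`χ_f(z∕z̄) = (ψ̃⁻¹ (η̃⁻¹ψ̃⁻¹μω)²)((1_∞, z))`), and derives (Dν)∕(Dψ) from these pins (`splitNu0_eq_localComponent_of_pin`,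
`locPsi_eq_wReading_mul_zpow_of_pins`; the former through ★ p817805 GRD-LOC).  This file plugs the pins into the (S)-closer: ONE theorem, stated over
the ★ Literature vocabulary `GelbartRogawski1991.ThetaTypeAtCM` (p818127) BY NAME — token-identical to conjunct 1 of `GRDMatrixCM … ξ μω hμu (grdMu …)
(isConjugateSymplectic_grdMu …) (grdChi …)`; the Lines predicate `ThetaTypeAt` is recovered by ★ p818933 `thetaTypeAt_iff_CM` (`Iff.rfl`).

* `grdMatrix_split_grdMu_grdChi` — (S) at `(grdMu, grdChi)`.

## References
* [Rogawski1990] J. Rogawski, Ann. of Math. Stud. 123 (1990): Lemma 4.13.1 (b) p. 62; §12.2 (2) p. 174; §13.3 p. 195 (`φ = μ η̃`).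
* [GelbartRogawski1991] S. Gelbart, J. Rogawski, Invent. Math. 105 (1991): §5.1 (5.1.1), Lem. 5.1.2 p. 466.
* [Minguez2008] A. Mínguez, Ann. Sci. ÉNS 41 (2008): Thm. 1 (type II theta, split places).
* [Liu2021] Y. Liu, arXiv:2102.11518: Def. 4.11, App. D §D.1 (l. 5224).
-/

set_option autoImplicit false
-- the mandated namespace has the single-problem summit's repeated segment (`HodgeConjecture.HodgeConjecture`)
set_option linter.dupNamespace false

noncomputable section

open NumberField IsDedekindDomain
open scoped Matrix

namespace Summit.HodgeConjecture.HodgeConjecture.Cruxes.H413.F0P2iGRDSplitAtWitness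

open Literature.NumberTheory Literature.NumberTheory.Automorphic Literature.NumberTheory.Automorphic.UnitaryGroup
open Literature.NumberTheory.Automorphic.IdeleClassGroup
open Literature.NumberTheory.Automorphic.Liu2021 Literature.NumberTheory.Automorphic.Liu2021.Def411WeilCarriers
open Literature.NumberTheory.GelbartRogawski1991
open Literature.NumberTheory.GaloisRepresentations
open Literature.NumberTheory.Rogawski1990
open Summit.HodgeConjecture.HodgeConjecture.Cruxes.H413.F0P2iGRDWitness

set_option synthInstance.maxHeartbeats 400000 in
set_option maxHeartbeats 16000000 in
/-- **GRD-(S) AT THE DICTIONARY PAIR**: for every CM frame, every one-dimensional automorphic `ξ` of `H` and Rogawski's `μω` (unitary, `μω|_{𝕀_{L⁺}} =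
ε_{L∕L⁺}`), at every place `v` of `L⁺` SPLIT in `L`, every member `c` of every ξ-local family `Pv` is, for SOME line class `ε`, the theta type
`X_v(μ_ξ, ε, χ_f) ∘ κ_v⁻¹` — conjunct (S) of `GRDMatrixCM … ξ μω hμu (grdMu L ξ μω hμu) (isConjugateSymplectic_grdMu L ξ μω hμu hquad) (grdChi L ξ μω hquad)`
token for token.  Proof: ★ `grdMatrix_split_of_dictionary` at the pins of ★ `F0P2iGRDWitness` (`norm_grdChi_apply`, `continuous_grdChi`,
`splitNu0_eq_localComponent_of_pin ∘ semilocalComponent_toHeckeCharacter_grdMu`, `locPsi_eq_wReading_mul_zpow_of_pins ∘ grdChi_finAdelicCheck`), then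
★ `thetaTypeAt_iff_CM`. [cite: Rogawski1990, Lemma 4.13.1 (b) p. 62; §12.2 (2) p. 174; §13.3 p. 195] [cite: GelbartRogawski1991, §5.1 (5.1.1), Lem 5.1.2 p. 466]
[cite: Minguez2008, Thm. 1] -/
theorem grdMatrix_split_grdMu_grdChi
    (L : Type) [Field L] [NumberField L] [IsCMField L] (H : Matrix (Fin 3) (Fin 3) L) (hH : (H.map (cmConjRingHom L))ᵀ = H) (hHd : IsUnit H.det)
    {n' : ℕ} (e₁ : Fin 3 × Fin 1 ≃ Fin n') (dV : Fin 3 → L) (hdV : ∀ i, IsCMField.complexConj L (dV i) = dV i) (hdV0 : ∀ i, dV i ≠ 0) (g : GL (Fin 3) L)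
    (hg : ((g : Matrix (Fin 3) (Fin 3) L).map (cmConjRingHom L))ᵀ * H * (g : Matrix (Fin 3) (Fin 3) L) = Matrix.diagonal dV)
    (ξ : OneDimAutRepH L) (μω : HeckeCharacter L) (hμu : μω.IsUnitary)
    (hquad : ∀ x : Literature.NumberTheory.GaloisRepresentations.ideleGroup ↥(maximalRealSubfield L),
      μω (AdeleRing.ideleBaseChange (↥(maximalRealSubfield L)) L x) = quadraticHeckeCharCM L x) :
    ∀ Pv : ∀ v : HeightOneSpectrum (𝓞 ↥(maximalRealSubfield L)), CMLocalAPacket L H v,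
      ξ.IsXiLocalFamily hH hHd μω hμu Pv →
      ∀ (v : HeightOneSpectrum (𝓞 ↥(maximalRealSubfield L))),
        (∃ w : PlacesOver L v, IsCMField.complexConj L • w.1 ≠ w.1) →
        ∀ c : IrrClass ((cmDatum L 3 H).Local v), c ∈ (Pv v).members →
          ∃ ε : (↥(maximalRealSubfield L))ˣ,
            ThetaTypeAtCM L H e₁ dV hdV hdV0 g hg (grdMu L ξ μω hμu) (isConjugateSymplectic_grdMu L ξ μω hμu hquad)
              (grdChi L ξ μω hquad) ε v c := by
  intro Pv hPv v hs c hc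
  obtain ⟨ε, hΘ⟩ := F0P2iGRDSplit.grdMatrix_split_of_dictionary L H hH hHd e₁ dV hdV hdV0 g hg ξ μω hμu (grdMu L ξ μω hμu)
    (isConjugateSymplectic_grdMu L ξ μω hμu hquad) (grdChi L ξ μω hquad) (norm_grdChi_apply L ξ hμu hquad) (continuous_grdChi L ξ μω hquad)
    (fun v' w _ => splitNu0_eq_localComponent_of_pin L ξ μω (grdMu L ξ μω hμu) v'
      (semilocalComponent_toHeckeCharacter_grdMu L ξ μω hμu v') w)
    (fun v' w _ => locPsi_eq_wReading_mul_zpow_of_pins L ξ μω (grdMu L ξ μω hμu) (grdChi L ξ μω hquad)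
      (Def411WeilCarriers.complexConj_mul_complexConj' L) (grdChi_finAdelicCheck L ξ μω hquad _) v'
      (semilocalComponent_toHeckeCharacter_grdMu L ξ μω hμu v') w)
    Pv hPv v hs c hc
  exact ⟨ε, (F0P2iVocabularyBridge.thetaTypeAt_iff_CM L H e₁ dV hdV hdV0 g hg (grdMu L ξ μω hμu)
    (isConjugateSymplectic_grdMu L ξ μω hμu hquad) (grdChi L ξ μω hquad) ε v c).1 hΘ⟩

end Summit.HodgeConjecture.HodgeConjecture.Cruxes.H413.F0P2iGRDSplitAtWitness

end
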